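import Mathlib
import Summits.NavierStokesRegularity.NavierStokesRegularity.Theorems.FilamentSkeletonRssSelectionBoxRJRungModelArcSlip

/-!
# Route `FilamentSkeletonRss` · crux `SelectionBoxRJ` (stmt-NavierStokesRegularity-21220) — rung tools (R1):
# the stagnation zero of a near-straight arc under a forcing close to rung 0's

Lane `ns-filament-19175-p1` (g7); helper file `--supports stmt-NavierStokesRegularity-21220`, route-independent.  Continues
`…RungModelArcSlip.lean` (same ABSTRACT setting: `C²` unit-speed arc `x` through the rung-0 waist point with
`‖x′ − e‖ ≤ θ` on `ℝ`, solving `x″ = c(t) • x′ × (V(x) + f)` for some coefficient function `c`, forcing `f` with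
`‖f − U‖ ≤ ε₀√Γ`, `‖f′ − U′‖ ≤ ε₁`, `U` the frozen rung-0 partner forcing; slip `w = ⟪x′, V(x) + f⟫`).

For `Γ ≥ 10⁴`, `0 ≤ θ ≤ 1/500`, `ε₀ ≤ 1/100`, `ε₁ ≤ 1/10`:
* `slip_neg_at` / `slip_pos_at` — `w(−(9/20)√Γ) < 0 < w(−(7/20)√Γ)` (rung-0 margins `∓1/10` beat the `C⁰` error);
* `slip_pos_of_nonneg` — `w > 0` on `[0, ∞)` (rung 0's `F ≥ 1/12` on `[0, 2]`, linear growth beyond);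
* `slip_strictMonoOn_Iic` — `w` is strictly increasing on `(−∞, 0]` (`w′ ≥ ½ − 12θ − ε₁ > 0` there, since rung 0's partner
  strain is stretching for `t ≤ 0`);
* `slip_zero_package` — hence EXACTLY ONE zero `c₀` on `ℝ`, with `−(9/20)√Γ < c₀ < −(7/20)√Γ`, waist `‖x c₀‖ ≤ √Γ/2`, tilt
  `|⟪x′ c₀, e₃⟫| ≤ 4/5`, and SUPERCRITICAL slope `37/20 ≤ w′ c₀ ≤ 13/4` — clauses 9, 10, 11 of `SelectionBoxRJ` for the arc,
  in MODEL form (the slip is taken against `V + f`, not against the pair's regularised Biot–Savart field).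

HONEST FRAMING.  Perturbation bookkeeping for the MODEL rung of a HYPOTHETICAL filament box; nothing here is a claim about
Navier–Stokes regularity or blow-up.
-/

set_option linter.dupNamespace false -- `Theorems.…Theorems`-style path/namespace repetition is the tree convention

noncomputable section

namespace Summit.NavierStokesRegularity.NavierStokesRegularity.Theorems

open Set Function Filter Real
open Literature.Analysis.FluidPDE
open scoped InnerProductSpace Topology

namespace SelectionBoxRJRung


/-- **Sign at `−(9/20)√Γ`.**  Under the abstract hypotheses with `Γ ≥ 10⁴`, `0 ≤ θ ≤ 1/500`, `ε₀ ≤ 1/100`: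
`w(−(9/20)√Γ) < 0` (rung 0: `F(−9/20) < −1/10`; error `≤ (θ(3 + ε₀ + 9/2) + ε₀)√Γ`). [folklore] -/
theorem slip_neg_at {Γ θ ε₀ : ℝ} (hΓ : 10 ^ 4 ≤ Γ) (hθ0 : 0 ≤ θ) (hθ1 : θ ≤ 1 / 500) (hε₀ : ε₀ ≤ 1 / 100)
    (U : ℝ → EuclideanSpace ℝ (Fin 3))
    (hU : ∀ t, U t = (2 * Γ / Real.pi / (4 * Γ / 25 + 1 + t ^ 2)) •
      ((2 * Real.sqrt Γ / 5) • (WithLp.toLp 2 ![0, (Real.sqrt 2)⁻¹, (Real.sqrt 2)⁻¹] : EuclideanSpace ℝ (Fin 3)) -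
        t • WithLp.toLp 2 ![(1:ℝ), 0, 0]))
    {x f : ℝ → EuclideanSpace ℝ (Fin 3)} (hxd : Differentiable ℝ x) (hunit : ∀ t, ‖deriv x t‖ = 1)
    (hx0 : x 0 = WithLp.toLp 2 ![Real.sqrt Γ / 5, 0, 0])
    (hθ : ∀ s, ‖deriv x s - WithLp.toLp 2 ![0, (Real.sqrt 2)⁻¹, (Real.sqrt 2)⁻¹]‖ ≤ θ)
    (hf0 : ∀ t, ‖f t - U t‖ ≤ ε₀ * Real.sqrt Γ)
    (w : ℝ → ℝ) (hw : ∀ t, w t = ⟪deriv x t,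
        ((1 / 2 : ℝ) • x t - (21 / 5 : ℝ) • cross (EuclideanSpace.single 2 1) (x t)) + f t⟫_ℝ) :
    w (-(9 / 20) * Real.sqrt Γ) < 0 := by
  have hΓ0 : 0 < Γ := by linarith [show (0:ℝ) < 10 ^ 4 by norm_num]
  have hG : 0 < Real.sqrt Γ := Real.sqrt_pos.2 hΓ0
  have hε₀0 : 0 ≤ ε₀ := by have h := (norm_nonneg _).trans (hf0 0); nlinarith
  obtain ⟨hb1, hb2⟩ := b_bounds hΓ
  have h := slip_sub_profile_le hΓ0 hθ0 U hU hxd hunit hx0 hθ hf0 w hw (-(9 / 20) * Real.sqrt Γ)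
  have hs : -(9 / 20) * Real.sqrt Γ / Real.sqrt Γ = -9 / 20 := by field_simp
  rw [hs] at h
  have hF := F_neg_wide (b := 4 / 25 + 1 / Γ) hb1
  have habs : |(-(9 / 20) * Real.sqrt Γ)| = 9 / 20 * Real.sqrt Γ := by
    rw [abs_of_neg (by nlinarith [hG])]; ring
  rw [habs] at h
  have h2 := (abs_le.1 h).2
  nlinarith [mul_nonneg hθ0 hG.le, mul_nonneg hε₀0 hG.le, hF, hG, mul_nonneg (mul_nonneg hθ0 hε₀0) hG.le]

/-- **Sign at `−(7/20)√Γ`:** `0 < w(−(7/20)√Γ)` (rung 0: `F(−7/20) > 1/10`). [folklore] -/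
theorem slip_pos_at {Γ θ ε₀ : ℝ} (hΓ : 10 ^ 4 ≤ Γ) (hθ0 : 0 ≤ θ) (hθ1 : θ ≤ 1 / 500) (hε₀ : ε₀ ≤ 1 / 100)
    (U : ℝ → EuclideanSpace ℝ (Fin 3))
    (hU : ∀ t, U t = (2 * Γ / Real.pi / (4 * Γ / 25 + 1 + t ^ 2)) •
      ((2 * Real.sqrt Γ / 5) • (WithLp.toLp 2 ![0, (Real.sqrt 2)⁻¹, (Real.sqrt 2)⁻¹] : EuclideanSpace ℝ (Fin 3)) -
        t • WithLp.toLp 2 ![(1:ℝ), 0, 0]))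
    {x f : ℝ → EuclideanSpace ℝ (Fin 3)} (hxd : Differentiable ℝ x) (hunit : ∀ t, ‖deriv x t‖ = 1)
    (hx0 : x 0 = WithLp.toLp 2 ![Real.sqrt Γ / 5, 0, 0])
    (hθ : ∀ s, ‖deriv x s - WithLp.toLp 2 ![0, (Real.sqrt 2)⁻¹, (Real.sqrt 2)⁻¹]‖ ≤ θ)
    (hf0 : ∀ t, ‖f t - U t‖ ≤ ε₀ * Real.sqrt Γ)
    (w : ℝ → ℝ) (hw : ∀ t, w t = ⟪deriv x t,
        ((1 / 2 : ℝ) • x t - (21 / 5 : ℝ) • cross (EuclideanSpace.single 2 1) (x t)) + f t⟫_ℝ) :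
    0 < w (-(7 / 20) * Real.sqrt Γ) := by
  have hΓ0 : 0 < Γ := by linarith [show (0:ℝ) < 10 ^ 4 by norm_num]
  have hG : 0 < Real.sqrt Γ := Real.sqrt_pos.2 hΓ0
  have hε₀0 : 0 ≤ ε₀ := by have h := (norm_nonneg _).trans (hf0 0); nlinarith
  obtain ⟨hb1, hb2⟩ := b_bounds hΓ
  have h := slip_sub_profile_le hΓ0 hθ0 U hU hxd hunit hx0 hθ hf0 w hw (-(7 / 20) * Real.sqrt Γ)
  have hs : -(7 / 20) * Real.sqrt Γ / Real.sqrt Γ = -7 / 20 := by field_simp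
  rw [hs] at h
  have hF := F_pos_wide (b := 4 / 25 + 1 / Γ) hb1 hb2
  have habs : |(-(7 / 20) * Real.sqrt Γ)| = 7 / 20 * Real.sqrt Γ := by
    rw [abs_of_neg (by nlinarith [hG])]; ring
  rw [habs] at h
  have h2 := (abs_le.1 h).1
  nlinarith [mul_nonneg hθ0 hG.le, mul_nonneg hε₀0 hG.le, hF, hG, mul_nonneg (mul_nonneg hθ0 hε₀0) hG.le]

/-- **No zero on `[0, ∞)`:** `w t > 0` for `t ≥ 0` (rung 0: `F ≥ 1/12` on `[0, 2]` and `F(s) > s/2 − 3/5`; the error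
`θ((3 + ε₀)√Γ + 10 t) + ε₀√Γ` is beaten in both regimes when `θ ≤ 1/500`, `ε₀ ≤ 1/100`). [folklore] -/
theorem slip_pos_of_nonneg {Γ θ ε₀ : ℝ} (hΓ : 10 ^ 4 ≤ Γ) (hθ0 : 0 ≤ θ) (hθ1 : θ ≤ 1 / 500) (hε₀ : ε₀ ≤ 1 / 100)
    (U : ℝ → EuclideanSpace ℝ (Fin 3))
    (hU : ∀ t, U t = (2 * Γ / Real.pi / (4 * Γ / 25 + 1 + t ^ 2)) •
      ((2 * Real.sqrt Γ / 5) • (WithLp.toLp 2 ![0, (Real.sqrt 2)⁻¹, (Real.sqrt 2)⁻¹] : EuclideanSpace ℝ (Fin 3)) -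
        t • WithLp.toLp 2 ![(1:ℝ), 0, 0]))
    {x f : ℝ → EuclideanSpace ℝ (Fin 3)} (hxd : Differentiable ℝ x) (hunit : ∀ t, ‖deriv x t‖ = 1)
    (hx0 : x 0 = WithLp.toLp 2 ![Real.sqrt Γ / 5, 0, 0])
    (hθ : ∀ s, ‖deriv x s - WithLp.toLp 2 ![0, (Real.sqrt 2)⁻¹, (Real.sqrt 2)⁻¹]‖ ≤ θ)
    (hf0 : ∀ t, ‖f t - U t‖ ≤ ε₀ * Real.sqrt Γ)
    (w : ℝ → ℝ) (hw : ∀ t, w t = ⟪deriv x t,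
        ((1 / 2 : ℝ) • x t - (21 / 5 : ℝ) • cross (EuclideanSpace.single 2 1) (x t)) + f t⟫_ℝ)
    {t : ℝ} (ht : 0 ≤ t) : 0 < w t := by
  have hΓ0 : 0 < Γ := by linarith [show (0:ℝ) < 10 ^ 4 by norm_num]
  have hG : 0 < Real.sqrt Γ := Real.sqrt_pos.2 hΓ0
  have hε₀0 : 0 ≤ ε₀ := by have h := (norm_nonneg _).trans (hf0 0); nlinarith
  obtain ⟨hb1, hb2⟩ := b_bounds hΓ
  have h := slip_sub_profile_le hΓ0 hθ0 U hU hxd hunit hx0 hθ hf0 w hw t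
  rw [abs_of_nonneg ht] at h
  have h2 := (abs_le.1 h).1
  set s : ℝ := t / Real.sqrt Γ with hsdef
  have hts : t = s * Real.sqrt Γ := by rw [hsdef]; field_simp
  have hs0 : 0 ≤ s := by rw [hsdef]; positivity
  rcases le_or_gt s 2 with hs2 | hs2
  · have hF := F_ge_of_nonneg (b := 4 / 25 + 1 / Γ) hb1 hb2 hs0
    rw [hts] at h2 ⊢
    nlinarith [mul_nonneg hθ0 hG.le, mul_nonneg hε₀0 hG.le, hF, hG, mul_nonneg (mul_nonneg hθ0 hε₀0) hG.le,
      mul_nonneg (mul_nonneg hθ0 hs0) hG.le]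
  · have hF := F_gt_linear (b := 4 / 25 + 1 / Γ) hb1 s
    rw [hts] at h2 ⊢
    nlinarith [mul_nonneg hθ0 hG.le, mul_nonneg hε₀0 hG.le, hF, hG, mul_nonneg (mul_nonneg hθ0 hε₀0) hG.le,
      mul_nonneg (mul_nonneg hθ0 hs0) hG.le, mul_pos (by linarith : (0:ℝ) < s - 2) hG]

/-- **Strict monotonicity on `(−∞, 0]`:** there `w′ ≥ ½ − 12θ − ε₁ > 0` (rung 0's frozen partner strain `⟪U′, e⟫ ≥ 0` for
`t ≤ 0`). [folklore] -/
theorem slip_strictMonoOn_Iic {Γ θ ε₁ : ℝ} (hΓ : 10 ^ 4 ≤ Γ) (hθ1 : θ ≤ 1 / 500) (hε₁ : ε₁ ≤ 1 / 10)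
    (U : ℝ → EuclideanSpace ℝ (Fin 3))
    (hU : ∀ t, U t = (2 * Γ / Real.pi / (4 * Γ / 25 + 1 + t ^ 2)) •
      ((2 * Real.sqrt Γ / 5) • (WithLp.toLp 2 ![0, (Real.sqrt 2)⁻¹, (Real.sqrt 2)⁻¹] : EuclideanSpace ℝ (Fin 3)) -
        t • WithLp.toLp 2 ![(1:ℝ), 0, 0]))
    {x f : ℝ → EuclideanSpace ℝ (Fin 3)} {c : ℝ → ℝ} (hx : ContDiff ℝ 2 x) (hunit : ∀ t, ‖deriv x t‖ = 1)
    (hθ : ∀ s, ‖deriv x s - WithLp.toLp 2 ![0, (Real.sqrt 2)⁻¹, (Real.sqrt 2)⁻¹]‖ ≤ θ)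
    (hode : ∀ t, iteratedDeriv 2 x t = c t • cross (deriv x t)
      ((1 / 2 : ℝ) • x t - (21 / 5 : ℝ) • cross (EuclideanSpace.single 2 1) (x t) + f t))
    (hf : Differentiable ℝ f) (hf1 : ∀ t, ‖deriv f t - deriv U t‖ ≤ ε₁)
    (w : ℝ → ℝ) (hw : ∀ t, w t = ⟪deriv x t,
        ((1 / 2 : ℝ) • x t - (21 / 5 : ℝ) • cross (EuclideanSpace.single 2 1) (x t)) + f t⟫_ℝ) :
    StrictMonoOn w (Iic 0) := by
  have hΓ0 : 0 < Γ := by linarith [show (0:ℝ) < 10 ^ 4 by norm_num]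
  have hwf : w = fun s => ⟪deriv x s,
      ((1 / 2 : ℝ) • x s - (21 / 5 : ℝ) • cross (EuclideanSpace.single 2 1) (x s)) + f s⟫_ℝ := funext hw
  refine strictMonoOn_of_hasDerivAt_pos (convex_Iic 0) (f' := deriv w)
    (fun t _ => by rw [hwf]; exact (cutoff_slip_hasDerivAt hx hunit hode hf t).differentiableAt.hasDerivAt)
    (fun t ht => ?_)
  have h := slip_deriv_sub_le hΓ0 U hU hx hunit hθ hode hf hf1 w hw t
  have hpos := inner_U_deriv_eT_nonneg hΓ0.le U hU (mem_Iic.1 ht)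
  have h2 := (abs_le.1 h).1
  linarith

/-- **The stagnation-zero package of the model rung.**  Under the abstract hypotheses with `Γ ≥ 10⁴`, `0 ≤ θ ≤ 1/500`,
`ε₀ ≤ 1/100`, `ε₁ ≤ 1/10`: the slip `w` is differentiable and has EXACTLY ONE zero `c₀` on `ℝ`; every zero satisfies
`−(9/20)√Γ < c₀ < −(7/20)√Γ`, waist `‖x c₀‖ ≤ √Γ/2`, tilt `|⟪x′ c₀, e₃⟫| ≤ 1 − 1/5`, and the SUPERCRITICAL slope window
`37/20 ≤ w′ c₀ ≤ 13/4` (rung 0: `[2, 31/10]`, widened by `12θ + ε₁ ≤ 3/20`). [folklore] -/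
theorem slip_zero_package {Γ θ ε₀ ε₁ : ℝ} (hΓ : 10 ^ 4 ≤ Γ) (hθ0 : 0 ≤ θ) (hθ1 : θ ≤ 1 / 500) (hε₀ : ε₀ ≤ 1 / 100)
    (hε₁ : ε₁ ≤ 1 / 10) (U : ℝ → EuclideanSpace ℝ (Fin 3))
    (hU : ∀ t, U t = (2 * Γ / Real.pi / (4 * Γ / 25 + 1 + t ^ 2)) •
      ((2 * Real.sqrt Γ / 5) • (WithLp.toLp 2 ![0, (Real.sqrt 2)⁻¹, (Real.sqrt 2)⁻¹] : EuclideanSpace ℝ (Fin 3)) -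
        t • WithLp.toLp 2 ![(1:ℝ), 0, 0]))
    {x f : ℝ → EuclideanSpace ℝ (Fin 3)} {c : ℝ → ℝ} (hx : ContDiff ℝ 2 x) (hunit : ∀ t, ‖deriv x t‖ = 1)
    (hx0 : x 0 = WithLp.toLp 2 ![Real.sqrt Γ / 5, 0, 0])
    (hθ : ∀ s, ‖deriv x s - WithLp.toLp 2 ![0, (Real.sqrt 2)⁻¹, (Real.sqrt 2)⁻¹]‖ ≤ θ)
    (hode : ∀ t, iteratedDeriv 2 x t = c t • cross (deriv x t)
      ((1 / 2 : ℝ) • x t - (21 / 5 : ℝ) • cross (EuclideanSpace.single 2 1) (x t) + f t))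
    (hf : Differentiable ℝ f) (hf0 : ∀ t, ‖f t - U t‖ ≤ ε₀ * Real.sqrt Γ) (hf1 : ∀ t, ‖deriv f t - deriv U t‖ ≤ ε₁)
    (w : ℝ → ℝ) (hw : ∀ t, w t = ⟪deriv x t,
        ((1 / 2 : ℝ) • x t - (21 / 5 : ℝ) • cross (EuclideanSpace.single 2 1) (x t)) + f t⟫_ℝ) :
    Differentiable ℝ w ∧
    (∃ c₀ : ℝ, w c₀ = 0 ∧ ∀ τ, w τ = 0 → τ = c₀) ∧
    (∀ c₀ : ℝ, w c₀ = 0 →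
      -(9 / 20) * Real.sqrt Γ < c₀ ∧ c₀ < -(7 / 20) * Real.sqrt Γ ∧ ‖x c₀‖ ≤ Real.sqrt Γ / 2 ∧
      |⟪deriv x c₀, EuclideanSpace.single 2 1⟫_ℝ| ≤ 1 - 1 / 5 ∧
      37 / 20 ≤ deriv w c₀ ∧ deriv w c₀ ≤ 13 / 4) := by
  have hΓ0 : 0 < Γ := by linarith [show (0:ℝ) < 10 ^ 4 by norm_num]
  have hG : 0 < Real.sqrt Γ := Real.sqrt_pos.2 hΓ0
  have hxd : Differentiable ℝ x := hx.differentiable (by norm_num)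
  have hwf : w = fun s => ⟪deriv x s,
      ((1 / 2 : ℝ) • x s - (21 / 5 : ℝ) • cross (EuclideanSpace.single 2 1) (x s)) + f s⟫_ℝ := funext hw
  have hwd : ∀ t, HasDerivAt w (1 / 2 + ⟪deriv f t, deriv x t⟫_ℝ) t := fun t => by
    rw [hwf]; exact cutoff_slip_hasDerivAt hx hunit hode hf t
  have hdiff : Differentiable ℝ w := fun t => (hwd t).differentiableAt
  have hcont : Continuous w := hdiff.continuous
  have hneg := slip_neg_at hΓ hθ0 hθ1 hε₀ U hU hxd hunit hx0 hθ hf0 w hw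
  have hpos := slip_pos_at hΓ hθ0 hθ1 hε₀ U hU hxd hunit hx0 hθ hf0 w hw
  have hmono := slip_strictMonoOn_Iic hΓ hθ1 hε₁ U hU hx hunit hθ hode hf hf1 w hw
  have hposR : ∀ t, 0 ≤ t → 0 < w t := fun t ht =>
    slip_pos_of_nonneg hΓ hθ0 hθ1 hε₀ U hU hxd hunit hx0 hθ hf0 w hw ht
  -- location of every zero
  have hloc : ∀ c₀, w c₀ = 0 → -(9 / 20) * Real.sqrt Γ < c₀ ∧ c₀ < -(7 / 20) * Real.sqrt Γ := by
    intro c₀ hc₀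
    have hc₀neg : c₀ < 0 := by
      by_contra h; exact absurd hc₀ (hposR c₀ (not_lt.1 h)).ne'
    have ha : -(9 / 20) * Real.sqrt Γ ∈ Iic (0:ℝ) := by simp [mem_Iic]
    have hb : -(7 / 20) * Real.sqrt Γ ∈ Iic (0:ℝ) := by simp [mem_Iic]
    have hc : c₀ ∈ Iic (0:ℝ) := hc₀neg.le
    constructor
    · by_contra h
      rw [not_lt] at h
      have := hmono.monotoneOn hc ha h
      linarith
    · by_contra h
      rw [not_lt] at h
      have := hmono.monotoneOn hb hc h
      linarith
  refine ⟨hdiff, ?_, ?_⟩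
  · -- existence and uniqueness
    have hab : -(9 / 20) * Real.sqrt Γ ≤ -(7 / 20) * Real.sqrt Γ := by nlinarith
    obtain ⟨c₀, _, hc₀⟩ := intermediate_value_Ioo hab hcont.continuousOn ⟨hneg, hpos⟩
    refine ⟨c₀, hc₀, fun τ hτ => ?_⟩
    have hτ0 : τ < 0 := by
      by_contra h; exact absurd hτ (hposR τ (not_lt.1 h)).ne'
    have hc0 : c₀ < 0 := by
      have := (hloc c₀ hc₀).2; nlinarith
    exact hmono.injOn (show τ ∈ Iic (0:ℝ) from hτ0.le) (show c₀ ∈ Iic (0:ℝ) from hc0.le) (hτ.trans hc₀.symm)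
  · intro c₀ hc₀
    obtain ⟨hc1, hc2⟩ := hloc c₀ hc₀
    have hcabs : |c₀| ≤ 9 / 20 * Real.sqrt Γ := by rw [abs_of_neg (by nlinarith)]; linarith
    refine ⟨hc1, hc2, ?_, ?_, ?_⟩
    · -- waist
      have hd := arc_displacement_le hxd hx0 hθ c₀
      have hℓ2 := norm_sq_line Γ c₀ hΓ0.le
      set L := ‖(WithLp.toLp 2 ![Real.sqrt Γ / 5, 0, 0] : EuclideanSpace ℝ (Fin 3)) +
        c₀ • WithLp.toLp 2 ![0, (Real.sqrt 2)⁻¹, (Real.sqrt 2)⁻¹]‖ with hL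
      have hLn : 0 ≤ L := norm_nonneg _
      have hG2 : Real.sqrt Γ ^ 2 = Γ := Real.sq_sqrt hΓ0.le
      have hL2 : L ^ 2 ≤ (493 / 1000 * Real.sqrt Γ) ^ 2 := by
        rw [hℓ2]; nlinarith [hG2]
      have hLle : L ≤ 493 / 1000 * Real.sqrt Γ := by
        nlinarith [hL2, hLn, hG]
      have htri : ‖x c₀‖ ≤ L + θ * |c₀| := by
        have := norm_add_le ((WithLp.toLp 2 ![Real.sqrt Γ / 5, 0, 0] : EuclideanSpace ℝ (Fin 3)) +
          c₀ • WithLp.toLp 2 ![0, (Real.sqrt 2)⁻¹, (Real.sqrt 2)⁻¹])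
          (x c₀ - ((WithLp.toLp 2 ![Real.sqrt Γ / 5, 0, 0] : EuclideanSpace ℝ (Fin 3)) +
            c₀ • WithLp.toLp 2 ![0, (Real.sqrt 2)⁻¹, (Real.sqrt 2)⁻¹]))
        rw [add_sub_cancel] at this
        linarith
      nlinarith [mul_le_mul hθ1 hcabs (abs_nonneg _) (by norm_num), hG]
    · -- tilt at the zero
      have he3 : ‖(EuclideanSpace.single (2 : Fin 3) (1 : ℝ) : EuclideanSpace ℝ (Fin 3))‖ = 1 := by simp
      have hsplit : ⟪deriv x c₀, EuclideanSpace.single 2 1⟫_ℝ =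
          ⟪(WithLp.toLp 2 ![0, (Real.sqrt 2)⁻¹, (Real.sqrt 2)⁻¹] : EuclideanSpace ℝ (Fin 3)),
            EuclideanSpace.single 2 1⟫_ℝ +
          ⟪deriv x c₀ - WithLp.toLp 2 ![0, (Real.sqrt 2)⁻¹, (Real.sqrt 2)⁻¹], EuclideanSpace.single 2 1⟫_ℝ := by
        rw [← inner_add_left, add_sub_cancel]
      have he : ⟪(WithLp.toLp 2 ![0, (Real.sqrt 2)⁻¹, (Real.sqrt 2)⁻¹] : EuclideanSpace ℝ (Fin 3)),
          EuclideanSpace.single 2 1⟫_ℝ = (Real.sqrt 2)⁻¹ := by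
        rw [single_two_eq_vec3, inner_vec3]; ring
      have hrest : |⟪deriv x c₀ - WithLp.toLp 2 ![0, (Real.sqrt 2)⁻¹, (Real.sqrt 2)⁻¹],
          (EuclideanSpace.single 2 1 : EuclideanSpace ℝ (Fin 3))⟫_ℝ| ≤ θ := by
        calc _ ≤ ‖deriv x c₀ - WithLp.toLp 2 ![0, (Real.sqrt 2)⁻¹, (Real.sqrt 2)⁻¹]‖ *
              ‖(EuclideanSpace.single (2 : Fin 3) (1 : ℝ) : EuclideanSpace ℝ (Fin 3))‖ := abs_real_inner_le_norm _ _
          _ ≤ θ := by rw [he3, mul_one]; exact hθ c₀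
      obtain ⟨hs1, hs2⟩ := sqrt_two_bounds
      have hinv : (Real.sqrt 2)⁻¹ ≤ 0.70711 := by
        rw [inv_le_comm₀ (by positivity) (by norm_num)]; nlinarith
      have hinv0 : 0 ≤ (Real.sqrt 2)⁻¹ := by positivity
      rw [hsplit, he]
      have := abs_add_le ((Real.sqrt 2)⁻¹) (⟪deriv x c₀ - WithLp.toLp 2 ![0, (Real.sqrt 2)⁻¹, (Real.sqrt 2)⁻¹],
          (EuclideanSpace.single 2 1 : EuclideanSpace ℝ (Fin 3))⟫_ℝ)
      rw [abs_of_nonneg hinv0] at this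
      linarith
    · -- slope window
      obtain ⟨hb1, hb2⟩ := b_bounds hΓ
      have h := slip_deriv_sub_le hΓ0 U hU hx hunit hθ hode hf hf1 w hw c₀
      rw [inner_U_deriv_eT_eq_profile hΓ0 U hU c₀] at h
      have hs1 : -9 / 20 ≤ c₀ / Real.sqrt Γ := by rw [le_div_iff₀ hG]; linarith
      have hs2 : c₀ / Real.sqrt Γ ≤ -7 / 20 := by rw [div_le_iff₀ hG]; linarith
      obtain ⟨hw1, hw2⟩ := Fderiv_window_wide (b := 4 / 25 + 1 / Γ) hb1 hb2 hs1 hs2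
      obtain ⟨hl, hu⟩ := abs_le.1 h
      constructor
      · linarith
      · linarith

end SelectionBoxRJRung

end Summit.NavierStokesRegularity.NavierStokesRegularity.Theorems
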